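import Literature.NumberTheory.QuadraticFields.DedekindZetaReducedForms
import Literature.Computability.Cryptography.HallgrenClassGroupDiscriminant

/-!
# Stub `stub_nagellHit` of line `Sketch` (v4) for the crux `ArithStatLadder.IqThreeNotPPoly` (stmt-QuantumAdvantage-2422)

NAGELL'S ELEMENTARY 3-TORSION. For integers `a ≥ 2` and `B` with `gcd(a, B) = 1` and
`0 < 4a < d := 4a³ − B²`, if `−d` is the discriminant of an (imaginary) quadratic field `K` then
`3 ∣ h_K`: with `(1, ω)` an integral basis, `ω² = m + tω`, `d_K = t² + 4m = B² − 4a³`, put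
`k = (B + t)/2` and `η = ω − k` (so `N(η) = k² − tk − m = a³`, `η = (B' + √−d)/2`-type generator);
the ideal `𝔞 = (a, η)` satisfies `𝔞² = (a², η)`, `𝔞³ = (a³, η) = (η)` (composition of the
concordant forms `(a, ·, a²)`, `(a², ·, a)`, `(a³, ·, 1)`: `nagell_span_pair_mul_span_pair`), and `𝔞` is
not principal: `N𝔞 = a` while an element `x + yω` of norm `a` has `4a = (2x + ty)² + d y²`, forcing
`y = 0`, `x² = a`, `𝔞 = (x)` — impossible as `η ∉ (x)` for `|x| > 1` (`nagell_not_isPrincipal`).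
Hence `[𝔞]` has order `3` in `Cl(K)` and `3 ∣ h_K` (`nagell_three_dvd_classNumber`). This is the
classical device of T. Nagell, *Über die Klassenzahl imaginär-quadratischer Zahlkörper*, Abh. Math.
Sem. Univ. Hamburg 1 (1922), 140–150, §§1–2 (infinitely many imaginary quadratic fields with class
number divisible by a given `n`, via `x² + d = 4yⁿ`-type representations); cf. Cohen, GTM 138, §5.

THE STUB: the sampler of the line outputs `d = N s (4c³ − N s)` with `c = 1 + 2^30 N^5`,
`s = 1 + 6cNk`; when `−d` is fundamental (in particular `d ≠ 0`, no truncation, `N ≥ 1`) we have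
`d = 4c⁶ − (2c³ − N s)² = 4a³ − B²` with `a = c² ≥ 4`, `B = 2c³ − N s`, `gcd(a, B) = 1`
(`c ≡ 1 (mod N)`, `s ≡ 1 (mod c)`) and `4a < d`, so `3 ∣ h(−d)` by the above and the PROVED
bridge `h(−d) = h_K` (`IsNegFundamentalDiscr.classNumber_eq`, `…exists_numberField`).
Everything over the tree's form–ideal dictionary (`Quadratic.sub_mul_sub_eq`,
`mem_span_pair_iff_of_basis`, `absNorm_span_pair_eq`, `norm_intCast_add_intCast_mul`,
`exists_basis_zero_eq_one`, `discr_eq_sq_add_four_mul`). Theorems only; sorry-free.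
-/

set_option linter.dupNamespace false -- D-0017: single-problem summit ⇒ `QuantumAdvantage.QuantumAdvantage` by design

noncomputable section

namespace Summit.QuantumAdvantage.QuantumAdvantage.Theorems.IqThreeNotPPoly

open scoped Classical nonZeroDivisors
open Module NumberField Ideal
open Literature.Computability.Cryptography (IsNegFundamentalDiscr)
open Literature.NumberTheory.QuadraticFields Literature.NumberTheory.QuadraticFields.Quadratic

/-! ### Concordant composition with a common second generator (quadratic ring level) -/

section QuadraticRing

variable {R : Type*} [CommRing R] (b : Basis (Fin 2) ℤ R) {t m : ℤ}
  (hω : b 1 * b 1 = (m : R) + (t : R) * b 1)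

include hω in
/-- **Composition of concordant forms with a common `η = ω − k`.** If `a₁ a₂ ∣ N(η)`, i.e.
`a₁ a₂ C = k² − tk − m`, and `gcd(a₁, a₂, 2k − t) = 1` (Bezout form), then
`(a₁, η) · (a₂, η) = (a₁ a₂, η)` (Dirichlet's united forms; Cox, *Primes of the form x² + ny²*,
Lemma 3.2 / (7.12); the tree's `span_pair_mul_span_pair_of_isCoprime` is the case `gcd(a₁, a₂) = 1`).
[cite: Cox2013, §3.A Lemma 3.2] -/
theorem nagell_span_pair_mul_span_pair {a₁ a₂ k C : ℤ} (hn : a₁ * a₂ * C = k ^ 2 - t * k - m)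
    (hco : ∃ u v w : ℤ, u * a₁ + v * a₂ + w * (t - 2 * k) = 1) :
    Ideal.span {(a₁ : R), b 1 - k} * Ideal.span {(a₂ : R), b 1 - k} =
      Ideal.span {((a₁ * a₂ : ℤ) : R), b 1 - k} := by
  set η : R := b 1 - k with hη
  have hηη : η * η = ((t - 2 * k : ℤ) : R) * η - (C : R) * ((a₁ * a₂ : ℤ) : R) := by
    have h := sub_mul_sub_eq b hω k
    rw [← hn] at h
    rw [hη, h]
    push_cast
    ring
  rw [Ideal.span_pair_mul_span_pair]
  apply le_antisymm
  · rw [Ideal.span_le]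
    have hgen₁ : ((a₁ * a₂ : ℤ) : R) ∈ Ideal.span {((a₁ * a₂ : ℤ) : R), η} :=
      Ideal.subset_span (by simp)
    have hgen₂ : η ∈ Ideal.span {((a₁ * a₂ : ℤ) : R), η} := Ideal.subset_span (by simp)
    rintro y (rfl | rfl | rfl | rfl)
    · push_cast at hgen₁ ⊢
      exact hgen₁
    · exact Ideal.mul_mem_left _ _ hgen₂
    · exact Ideal.mul_mem_right _ _ hgen₂
    · rw [hηη]
      exact Ideal.sub_mem _ (Ideal.mul_mem_left _ _ hgen₂) (Ideal.mul_mem_left _ _ hgen₁)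
  · rw [Ideal.span_le]
    obtain ⟨u, v, w, huvw⟩ := hco
    rintro y (rfl | rfl)
    · have e : ((a₁ * a₂ : ℤ) : R) = (a₁ : R) * a₂ := by push_cast; ring
      rw [e]
      exact Ideal.subset_span (by simp)
    · have h1 := congrArg (Int.cast : ℤ → R) huvw
      push_cast at h1
      have key : η = (u : R) * ((a₁ : R) * η) + (v : R) * (η * a₂) + (w : R) * (η * η) +
          ((w * C : ℤ) : R) * ((a₁ : R) * a₂) := by
        rw [hηη]
        push_cast
        linear_combination (-η) * h1
      have hmem : (u : R) * ((a₁ : R) * η) + (v : R) * (η * a₂) + (w : R) * (η * η) +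
          ((w * C : ℤ) : R) * ((a₁ : R) * a₂) ∈
          Ideal.span {(a₁ : R) * a₂, (a₁ : R) * η, η * a₂, η * η} :=
        Ideal.add_mem _
          (Ideal.add_mem _
            (Ideal.add_mem _ (Ideal.mul_mem_left _ _ (Ideal.subset_span (by simp)))
              (Ideal.mul_mem_left _ _ (Ideal.subset_span (by simp))))
            (Ideal.mul_mem_left _ _ (Ideal.subset_span (by simp))))
          (Ideal.mul_mem_left _ _ (Ideal.subset_span (by simp)))
      rwa [← key] at hmem

include hω in
/-- **The cube of Nagell's ideal is principal**: if `N(η) = k² − tk − m = a³` and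
`gcd(a, 2k − t) = 1` then `(a, η)³ = (η)` — `(a, η)² = (a², η)`, `(a², η)(a, η) = (a³, η)`, and
`a³ = N(η) ∈ (η)`. [cite: Cox2013, §3.A Lemma 3.2] -/
theorem nagell_span_pair_pow_three {a k : ℤ} (hn : a * a * a = k ^ 2 - t * k - m)
    (hco : IsCoprime a (t - 2 * k)) :
    Ideal.span {(a : R), b 1 - k} ^ 3 = Ideal.span {b 1 - k} := by
  obtain ⟨u, w, huw⟩ := hco
  -- `(a, η)² = (a², η)`
  have h2 : Ideal.span {(a : R), b 1 - k} * Ideal.span {(a : R), b 1 - k} =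
      Ideal.span {((a * a : ℤ) : R), b 1 - k} :=
    nagell_span_pair_mul_span_pair b hω (C := a) hn ⟨u, 0, w, by linear_combination huw⟩
  -- `(a², η)(a, η) = (a³, η)`
  have h3 : Ideal.span {((a * a : ℤ) : R), b 1 - k} * Ideal.span {(a : R), b 1 - k} =
      Ideal.span {((a * a * a : ℤ) : R), b 1 - k} :=
    nagell_span_pair_mul_span_pair b hω (C := 1) (by linear_combination hn)
      ⟨0, u, w, by linear_combination huw⟩
  rw [pow_three, ← mul_assoc, h2, h3]
  -- `(a³, η) = (η)` since `a³ = N(η) = (t − 2k)η − η²`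
  have hnorm : ((a * a * a : ℤ) : R) ∈ Ideal.span {b 1 - k} := by
    have h := sub_mul_sub_eq b hω k
    rw [← hn] at h
    have e : ((a * a * a : ℤ) : R) = (((t - 2 * k : ℤ) : R) - (b 1 - k)) * (b 1 - k) := by
      linear_combination h
    rw [e]
    exact Ideal.mul_mem_left _ _ (Ideal.mem_span_singleton_self _)
  apply le_antisymm
  · rw [Ideal.span_le]
    rintro y (rfl | rfl)
    · exact hnorm
    · exact Ideal.mem_span_singleton_self _
  · exact Ideal.span_mono (by simp)

end QuadraticRing

/-! ### Non-principality and the order-`3` class (ring of integers level) -/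

section RingOfIntegers

variable {K : Type*} [Field K] [NumberField K]

/-- **Nagell's ideal is not principal.** Let `(1, ω)` be an integral basis of the quadratic field
`K`, `ω² = m + tω`, `d_K = t² + 4m < 0`, and `a C = k² − tk − m` with `2 ≤ a` and `4a < −d_K`. Then
`(a, ω − k)` is not principal: it has norm `a` (`absNorm_span_pair_eq`), an element `x + yω` of norm
`a` has `4a = (2x + ty)² − d_K y²`, so `y = 0` and `x² = a`, and then `ω − k ∈ (x)` forces `x = ±1`.
[cite: Cox2013, §7.B Thm. 7.7] -/
theorem nagell_not_isPrincipal (b : Basis (Fin 2) ℤ (𝓞 K)) (hb : b 0 = 1) {t m : ℤ}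
    (hω : b 1 * b 1 = (m : 𝓞 K) + (t : 𝓞 K) * b 1) {a k C : ℤ} (hn : a * C = k ^ 2 - t * k - m)
    (ha : 2 ≤ a) (hlt : 4 * a < -(t ^ 2 + 4 * m)) :
    ¬ (Ideal.span {(a : 𝓞 K), b 1 - k}).IsPrincipal := by
  intro hP
  obtain ⟨⟨γ, hγ⟩⟩ := hP
  rw [Ideal.submodule_span_eq] at hγ
  have hneg : 0 < -(t ^ 2 + 4 * m) := by linarith
  -- the norm of the generator is `a`
  have hN : absNorm (Ideal.span {(a : 𝓞 K), b 1 - k}) = a.natAbs := absNorm_span_pair_eq b hb hω hn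
  rw [hγ, Ideal.absNorm_span_singleton] at hN
  obtain ⟨x, y, hxy⟩ : ∃ x y : ℤ, γ = (x : 𝓞 K) + (y : 𝓞 K) * b 1 :=
    ⟨_, _, eq_repr_add_repr_mul_of_basis b hb γ⟩
  have hnorm : Algebra.norm ℤ γ = x ^ 2 + t * x * y - m * y ^ 2 := by
    rw [hxy]; exact norm_intCast_add_intCast_mul b hb hω x y
  rw [hnorm] at hN
  have hnn : 0 ≤ x ^ 2 + t * x * y - m * y ^ 2 := by
    nlinarith [sq_nonneg (2 * x + t * y), mul_nonneg hneg.le (sq_nonneg y)]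
  have hval : x ^ 2 + t * x * y - m * y ^ 2 = a := by
    have h1 : ((x ^ 2 + t * x * y - m * y ^ 2).natAbs : ℤ) = (a.natAbs : ℤ) := by exact_mod_cast hN
    rw [Int.natAbs_of_nonneg hnn, Int.natAbs_of_nonneg (by omega)] at h1
    exact h1
  -- `y = 0`
  have hy : y = 0 := by
    by_contra hy
    have hy1 : 1 ≤ |y| := Int.one_le_abs hy
    have hy2 : 1 ≤ y ^ 2 := by nlinarith [sq_abs y]
    nlinarith [sq_nonneg (2 * x + t * y), mul_le_mul_of_nonneg_left hy2 hneg.le]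
  subst hy
  have hx2 : x ^ 2 = a := by linear_combination hval
  -- `η = ω - k ∈ (x)` forces `x ∣ 1`
  have hη : b 1 - (k : 𝓞 K) ∈ Ideal.span {γ} := by
    rw [← hγ]; exact Ideal.subset_span (by simp)
  rw [Ideal.mem_span_singleton] at hη
  obtain ⟨δ, hδ⟩ := hη
  obtain ⟨p, q, hpq⟩ : ∃ p q : ℤ, δ = (p : 𝓞 K) + (q : 𝓞 K) * b 1 :=
    ⟨_, _, eq_repr_add_repr_mul_of_basis b hb δ⟩
  have hcoord : ((-k : ℤ) : 𝓞 K) + ((1 : ℤ) : 𝓞 K) * b 1 = ((x * p : ℤ) : 𝓞 K) + ((x * q : ℤ) : 𝓞 K) * b 1 := by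
    have e : b 1 - (k : 𝓞 K) = γ * δ := hδ
    rw [hxy, hpq] at e
    push_cast at e ⊢
    linear_combination e
  obtain ⟨-, h1⟩ := intCast_add_intCast_mul_inj b hb hcoord
  have hxu : IsUnit x := isUnit_iff_exists_inv.mpr ⟨q, h1.symm⟩
  rcases Int.isUnit_iff.1 hxu with rfl | rfl <;> norm_num at hx2 <;> omega

/-- **Nagell's 3-torsion (field form).** If the discriminant of the quadratic field `K` is
`B² − 4a³` with `2 ≤ a`, `gcd(a, B) = 1` and `4a < 4a³ − B²`, then `3 ∣ h_K`: the class of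
`𝔞 = (a, ω − k)`, `2k − t = B`, is non-trivial (`nagell_not_isPrincipal`) with trivial cube
(`nagell_span_pair_pow_three`), so it has order `3` in the finite group `Cl(𝓞 K)`.
[cite: Nagell1922, §1] -/
theorem nagell_three_dvd_classNumber (h2 : finrank ℚ K = 2) {a B : ℤ} (ha : 2 ≤ a)
    (hco : IsCoprime a B) (hdisc : NumberField.discr K = B ^ 2 - 4 * a ^ 3)
    (hlt : 4 * a < 4 * a ^ 3 - B ^ 2) : 3 ∣ NumberField.classNumber K := by
  obtain ⟨b, hb⟩ := exists_basis_zero_eq_one h2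
  set m : ℤ := b.repr (b 1 * b 1) 0 with hm
  set t : ℤ := b.repr (b 1 * b 1) 1 with ht
  have hω : b 1 * b 1 = (m : 𝓞 K) + (t : 𝓞 K) * b 1 := basis_one_mul_self_eq b hb
  have hD : NumberField.discr K = t ^ 2 + 4 * m := discr_eq_sq_add_four_mul b hb
  -- `B ≡ t (mod 2)`; `k = (B + t)/2`
  have E : t ^ 2 + 4 * m = B ^ 2 - 4 * a ^ 3 := hD.symm.trans hdisc
  have hpar : 2 ∣ B + t := by
    have h4 : B ^ 2 - t ^ 2 = 4 * (a ^ 3 + m) := by linear_combination -E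
    rcases Int.emod_two_eq_zero_or_one (B + t) with h | h
    · exact Int.dvd_of_emod_eq_zero h
    · exfalso
      have h' : (B - t) % 2 = 1 := by omega
      have hprod : (B + t) * (B - t) % 2 = 1 := by
        rw [Int.mul_emod, h, h']; decide
      have : (B + t) * (B - t) = 2 * (2 * (a ^ 3 + m)) := by linear_combination h4
      omega
  obtain ⟨k, hk⟩ := hpar
  have htk : t - 2 * k = -B := by linear_combination hk
  have hn : a * a * a = k ^ 2 - t * k - m := by
    have eB : B = 2 * k - t := by linear_combination hk
    have h4 : 4 * (a * a * a) = 4 * (k ^ 2 - t * k - m) := by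
      rw [eB] at E
      linear_combination E
    exact mul_left_cancel₀ (by norm_num : (4 : ℤ) ≠ 0) h4
  -- the ideal and its class
  have ha0 : (a : ℤ) ≠ 0 := by omega
  set 𝔞 : Ideal (𝓞 K) := Ideal.span {(a : 𝓞 K), b 1 - k} with h𝔞
  have h𝔞0 : 𝔞 ∈ (Ideal (𝓞 K))⁰ :=
    Literature.NumberTheory.EllipticCurves.span_pair_mem_nonZeroDivisors b hb ha0 k
  set g : ClassGroup (𝓞 K) := ClassGroup.mk0 ⟨𝔞, h𝔞0⟩ with hg
  -- `g³ = 1`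
  have hcube : 𝔞 ^ 3 = Ideal.span {b 1 - (k : 𝓞 K)} :=
    nagell_span_pair_pow_three b hω hn (by rw [htk]; exact hco.neg_right)
  have hpow0 : 𝔞 ^ 3 ∈ (Ideal (𝓞 K))⁰ := pow_mem h𝔞0 3
  have hg3 : g ^ 3 = 1 := by
    have e : (⟨𝔞, h𝔞0⟩ ^ 3 : (Ideal (𝓞 K))⁰) = ⟨𝔞 ^ 3, hpow0⟩ :=
      Subtype.ext (SubmonoidClass.coe_pow _ 3)
    rw [hg, ← map_pow, e, ClassGroup.mk0_eq_one_iff, hcube]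
    exact ⟨⟨b 1 - (k : 𝓞 K), (Ideal.submodule_span_eq).symm⟩⟩
  -- `g ≠ 1`
  have hg1 : g ≠ 1 := by
    rw [hg, Ne, ClassGroup.mk0_eq_one_iff]
    refine nagell_not_isPrincipal b hb hω (C := a * a) (by linear_combination hn) ha ?_
    rw [← hD, hdisc]
    linarith
  -- order `3`
  haveI : Fact (Nat.Prime 3) := ⟨Nat.prime_three⟩
  have hord : orderOf g = 3 := orderOf_eq_prime hg3 hg1
  rw [NumberField.classNumber, ← hord]
  exact orderOf_dvd_card

end RingOfIntegers

/-! ### The registered stub -/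

/-- `−0` is not a negative fundamental discriminant. [folklore] -/
private theorem not_isNegFundamentalDiscr_zero' : ¬ IsNegFundamentalDiscr 0 := by
  intro h
  rcases h with ⟨h1, -, -⟩ | ⟨-, h2, -⟩
  · norm_num at h1
  · norm_num at h2

/-- **STUB H · `stub_nagellHit`** (NAGELL'S ELEMENTARY 3-TORSION): for the sampler's output
`d = N s (4c³ − N s)`, `c = 1 + 2^30 N^5`, `s = 1 + 6cNk`, a fundamental `−d` forces `3 ∣ h(−d)`.
Indeed `d ≠ 0` rules out truncation and `N = 0`; then `d = 4c⁶ − (2c³ − N s)² = 4a³ − B²` with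
`a = c² ≥ 4`, `B = 2c³ − N s` coprime to `a` (`c ≡ 1 (mod N)`, `s ≡ 1 (mod c)`), and
`4a < 4c³ − 1 ≤ d`; apply `nagell_three_dvd_classNumber` in the quadratic field of discriminant
`−d` (`IsNegFundamentalDiscr.exists_numberField`) and the proved bridge `h(−d) = h_K`
(`IsNegFundamentalDiscr.classNumber_eq`). -/
theorem stub_nagellHit :
    ∀ (N k : ℕ),
      IsNegFundamentalDiscr (N * (1 + 6 * (1 + 2 ^ 30 * N ^ 5) * N * k) *
        (4 * (1 + 2 ^ 30 * N ^ 5) ^ 3 - N * (1 + 6 * (1 + 2 ^ 30 * N ^ 5) * N * k))) →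
      3 ∣ BinaryQuadraticForm.classNumber
        (-((N * (1 + 6 * (1 + 2 ^ 30 * N ^ 5) * N * k) *
          (4 * (1 + 2 ^ 30 * N ^ 5) ^ 3 - N * (1 + 6 * (1 + 2 ^ 30 * N ^ 5) * N * k)) : ℕ) : ℤ)) := by
  intro N k hfund
  -- abbreviations
  set c : ℕ := 1 + 2 ^ 30 * N ^ 5 with hc
  set s : ℕ := 1 + 6 * c * N * k with hs
  set d : ℕ := N * s * (4 * c ^ 3 - N * s) with hd
  -- no truncation, `N ≥ 1`
  have hd0 : d ≠ 0 := fun h0 => not_isNegFundamentalDiscr_zero' (h0 ▸ hfund)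
  have hlt : N * s < 4 * c ^ 3 := by
    by_contra hle
    apply hd0
    rw [hd, Nat.sub_eq_zero_of_le (not_lt.1 hle), mul_zero]
  have hN : 1 ≤ N := by
    rcases Nat.eq_zero_or_pos N with h | h
    · exfalso; apply hd0; rw [hd, h]; simp
    · exact h
  have hc2 : 2 ≤ c := by
    have h1 : 1 ≤ 2 ^ 30 * N ^ 5 := Nat.one_le_iff_ne_zero.2 (by positivity)
    have e : c = 1 + 2 ^ 30 * N ^ 5 := hc
    linarith
  have hs1 : 1 ≤ s := by rw [hs]; exact Nat.le_add_right 1 _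
  -- the integers `a = c²`, `B = 2c³ − N s`
  have hdZ : (d : ℤ) = 4 * ((c : ℤ) ^ 2) ^ 3 - (2 * (c : ℤ) ^ 3 - N * s) ^ 2 := by
    have e : ((4 * c ^ 3 - N * s : ℕ) : ℤ) = 4 * (c : ℤ) ^ 3 - N * s := by
      rw [Nat.cast_sub hlt.le]; push_cast; ring
    have e2 : (d : ℤ) = (N : ℤ) * s * ((4 * c ^ 3 - N * s : ℕ) : ℤ) := by
      rw [hd, Nat.cast_mul, Nat.cast_mul]
    rw [e2, e]; ring
  have hc2' : (2 : ℤ) ≤ c := by exact_mod_cast hc2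
  -- the quadratic field of discriminant `−d`
  obtain ⟨K, _, _, h2, hdisc⟩ := hfund.exists_numberField
  rw [hfund.classNumber_eq h2 hdisc]
  refine nagell_three_dvd_classNumber h2 (a := (c : ℤ) ^ 2) (B := 2 * (c : ℤ) ^ 3 - N * s) ?_ ?_ ?_ ?_
  · -- `2 ≤ a`
    nlinarith [hc2']
  · -- `gcd(c², 2c³ − N s) = 1`
    have hcN : IsCoprime (c : ℤ) (N : ℤ) := by
      refine ⟨1, -(2 ^ 30 * (N : ℤ) ^ 4), ?_⟩
      rw [hc]; push_cast; ring
    have hcs : IsCoprime (c : ℤ) (s : ℤ) := by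
      refine ⟨-(6 * (N : ℤ) * k), 1, ?_⟩
      rw [hs]; push_cast; ring
    have h1 : IsCoprime (c : ℤ) (-((N : ℤ) * s) + (c : ℤ) * (2 * (c : ℤ) ^ 2)) :=
      (hcN.mul_right hcs).neg_right.add_mul_left_right _
    have e : -((N : ℤ) * s) + (c : ℤ) * (2 * (c : ℤ) ^ 2) = 2 * (c : ℤ) ^ 3 - N * s := by ring
    rw [e] at h1
    exact h1.pow_left
  · -- the discriminant
    rw [hdisc, hdZ]; ring
  · -- `4a < d = 4a³ − B²`: `d = x y` with `x + y = 4c³`, `x, y ≥ 1`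
    have hxy : 4 * (c : ℤ) ^ 2 < ((N : ℤ) * s) * (4 * (c : ℤ) ^ 3 - N * s) := by
      have hx1 : 1 ≤ N * s := by simpa using Nat.mul_le_mul hN hs1
      have hx : (1 : ℤ) ≤ (N : ℤ) * s := by exact_mod_cast hx1
      have hy : (1 : ℤ) ≤ 4 * (c : ℤ) ^ 3 - N * s := by
        have : ((N * s : ℕ) : ℤ) < ((4 * c ^ 3 : ℕ) : ℤ) := by exact_mod_cast hlt
        push_cast at this
        linarith
      nlinarith [mul_nonneg (sub_nonneg.2 hx) (sub_nonneg.2 hy), sq_nonneg (c : ℤ),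
        mul_le_mul_of_nonneg_right hc2' (sq_nonneg (c : ℤ))]
    have e : 4 * ((c : ℤ) ^ 2) ^ 3 - (2 * (c : ℤ) ^ 3 - N * s) ^ 2 =
        ((N : ℤ) * s) * (4 * (c : ℤ) ^ 3 - N * s) := by ring
    rw [e]
    exact hxy

end Summit.QuantumAdvantage.QuantumAdvantage.Theorems.IqThreeNotPPoly

end
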